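import Mathlib
import Literature.NumberTheory.Automorphic.UnboundedDenominatorsReductions

/-!
# Stub `stub_sturmModPrimeLevelOne` for line `Sketch-ideate-r1-k1` (crux stmt-Langlands-8485)

**Sturm's congruence bound modulo `p` at level one, over `ℤ` (unconditional).**  If a modular
form `F ∈ M_k(SL₂(ℤ))` has rational-integer `q`-expansion coefficients `wₙ` and an integer `d`
divides `wₙ` for every `n ≤ ⌊k/12⌋`, then `d` divides every `wₙ`
(`levelOne_forall_dvd_coeff`; the registered stub is its cusp-form case at level `Γ₁(1) = SL₂(ℤ)`,
with `d = p` prime).  This is the `N = 1` case of Sturm 1987, Theorem 1, proved here from the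
Serre / Swinnerton-Dyer structure of level-one forms over `ℤ`, by strong induction on the weight:

* `M_k = 0` for `k < 0` (`ModularFormClass.levelOne_neg_weight_eq_zero`), for `k` odd
  (`ModularForm.levelOne_odd_weight_eq_zero`) and for `k = 2` (`levelOne_weight_two_rank_zero`);
* for `k` even, `k ≠ 2`, the level-one form `E := E₄ᵃ E₆ᵇ` (`4a + 6b = k`) has integer
  `q`-expansion with constant term `1` (tree: `E₄_qExpansion_coeff`, `E₆_qExpansion_coeff`), so
  `G := F - w₀ E` has integer coefficients `≡ wₙ (mod d)` and vanishing constant term, hence is a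
  cusp form (Mathlib `ModularForm.toCuspForm`) and `G = Δ · H` with `H ∈ M_{k-12}`
  (`CuspForm.discriminantEquiv`, `qExpansion_eq_qExpansion_discriminant_mul`); since
  `qExpansion 1 Δ = X · U` with `U ∈ ℤ⟦X⟧ˣ` (tree:
  `exists_discriminant_qExpansion_natCast_eq_X_pow_mul`), `H` has integer coefficients
  `hₙ = Σ_{i+j=n+1} vᵢ gⱼ` (`V = U⁻¹`), divisible by `d` for `n ≤ ⌊k/12⌋ - 1 = ⌊(k-12)/12⌋`; the
  induction hypothesis (or `M_{k-12} = 0` if `k < 12`) gives `d ∣ hₙ` for all `n`, whence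
  `d ∣ gₙ` and `d ∣ wₙ = gₙ + w₀ eₙ` for all `n`.

No new definitions, no named facts.
-/

set_option linter.dupNamespace false -- `Summit.Langlands.Langlands` is the mandated namespace

noncomputable section

open scoped MatrixGroups ModularForm
open UpperHalfPlane PowerSeries

namespace Summit.Langlands.Langlands.Theorems.HilbertIntegralOverconvergentIsCongruence

/-! ### Algebra in `ℤ⟦X⟧`: divisibility of coefficients -/

/-- If `d` divides the coefficients of `Q` in degrees `≤ m`, then `d` divides the degree-`m`
coefficient of `P * Q`. [folklore] -/
theorem dvd_coeff_mul_of_dvd_coeff_le {d : ℤ} (P : ℤ⟦X⟧) {Q : ℤ⟦X⟧} {m : ℕ}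
    (hQ : ∀ j ≤ m, d ∣ coeff j Q) : d ∣ coeff m (P * Q) := by
  rw [coeff_mul]
  exact Finset.dvd_sum fun x hx ↦
    dvd_mul_of_dvd_right (hQ x.2 (Finset.HasAntidiagonal.antidiagonal.snd_le hx)) _

/-- **Downward step.** If `d ∣ w₀` and `d` divides the coefficients of `W` in degrees `≤ B`, then
`d` divides the coefficients of `V * (W - w₀ W_E)` in degrees `≤ B`. [folklore] -/
theorem dvd_coeff_mul_sub_of_le {d w₀ : ℤ} (V W WE : ℤ⟦X⟧) {B : ℕ} (hw₀ : d ∣ w₀)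
    (hW : ∀ j ≤ B, d ∣ coeff j W) {n : ℕ} (hn : n ≤ B) :
    d ∣ coeff n (V * (W - C w₀ * WE)) := by
  refine dvd_coeff_mul_of_dvd_coeff_le V fun j hj ↦ ?_
  rw [map_sub, coeff_C_mul]
  exact dvd_sub (hW j (hj.trans hn)) (dvd_mul_of_dvd_left hw₀ _)

/-- **Upward step.** If `W - w₀ W_E = U · X · W_H` with `d ∣ w₀` and `d` dividing every
coefficient of `W_H`, then `d` divides every coefficient of `W`. [folklore] -/
theorem forall_dvd_coeff_of_sub_eq {d w₀ : ℤ} {W WE U WH : ℤ⟦X⟧} (hw₀ : d ∣ w₀)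
    (hfac : W - C w₀ * WE = U * (X * WH)) (hWH : ∀ m, d ∣ coeff m WH) (m : ℕ) :
    d ∣ coeff m W := by
  rw [sub_eq_iff_eq_add.mp hfac, map_add, coeff_C_mul]
  refine dvd_add (dvd_coeff_mul_of_dvd_coeff_le U fun j _ ↦ ?_) (dvd_mul_of_dvd_left hw₀ _)
  exact dvd_coeff_mul_of_dvd_coeff_le X fun i _ ↦ hWH i

/-- An integer power series whose image in `ℂ⟦X⟧` vanishes is zero. [folklore] -/
theorem eq_zero_of_map_intCast_eq_zero {W : ℤ⟦X⟧} (h : W.map (Int.castRingHom ℂ) = 0) :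
    W = 0 :=
  map_injective (Int.castRingHom ℂ) Int.cast_injective (by rw [h, map_zero])

/-! ### Level-one input: `E₄ᵃ E₆ᵇ` has integer `q`-expansion with constant term `1` -/

/-- `E₄ ∈ 1 + X ℤ⟦X⟧` (from the tree's `E₄ = 1 + 240 Σ σ₃(n) qⁿ`). [folklore] -/
theorem exists_E₄_qExpansion_eq_map_int :
    ∃ A : ℤ⟦X⟧, constantCoeff A = 1 ∧
      qExpansion 1 ⇑ModularForm.E₄ = A.map (Int.castRingHom ℂ) := by
  refine ⟨PowerSeries.mk fun n ↦ if n = 0 then 1 else 240 * (ArithmeticFunction.sigma 3 n : ℤ),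
    by rw [constantCoeff_mk, if_pos rfl], ?_⟩
  ext n
  rw [Literature.NumberTheory.Automorphic.E₄_qExpansion_coeff, coeff_map, coeff_mk]
  split_ifs <;> simp

/-- `E₆ ∈ 1 + X ℤ⟦X⟧` (from the tree's `E₆ = 1 - 504 Σ σ₅(n) qⁿ`). [folklore] -/
theorem exists_E₆_qExpansion_eq_map_int :
    ∃ A : ℤ⟦X⟧, constantCoeff A = 1 ∧
      qExpansion 1 ⇑ModularForm.E₆ = A.map (Int.castRingHom ℂ) := by
  refine ⟨PowerSeries.mk fun n ↦ if n = 0 then 1 else -504 * (ArithmeticFunction.sigma 5 n : ℤ),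
    by rw [constantCoeff_mk, if_pos rfl], ?_⟩
  ext n
  rw [Literature.NumberTheory.Automorphic.E₆_qExpansion_coeff, coeff_map, coeff_mk]
  split_ifs <;> simp

/-- **Integral level-one forms with constant term `1`.** For every even natural weight `K ≠ 2`
there is a modular form of weight `K` on `SL₂(ℤ)` whose `q`-expansion is the image of an integer
power series with constant term `1`, namely `E₄ᵃ E₆ᵇ` with `4a + 6b = K`. [folklore] -/
theorem exists_levelOne_qExpansion_eq_map_int {K : ℕ} (hK : Even K) (hK2 : K ≠ 2) :
    ∃ (E : ModularForm 𝒮ℒ (K : ℤ)) (A : ℤ⟦X⟧), constantCoeff A = 1 ∧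
      qExpansion 1 ⇑E = A.map (Int.castRingHom ℂ) := by
  obtain ⟨a, b, hab⟩ : ∃ a b : ℕ, 4 * a + 6 * b = K := by
    obtain ⟨r, hr⟩ := hK
    rcases Nat.even_or_odd r with ⟨s, hs⟩ | ⟨s, hs⟩
    · exact ⟨s, 0, by omega⟩
    · exact ⟨s - 1, 1, by omega⟩
  obtain ⟨A4, hA4, hE4⟩ := exists_E₄_qExpansion_eq_map_int
  obtain ⟨A6, hA6, hE6⟩ := exists_E₆_qExpansion_eq_map_int
  refine ⟨ModularForm.mcast (show (a : ℤ) * 4 + (b : ℤ) * 6 = (K : ℤ) by omega)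
    ((ModularForm.E₄.pow a).mul (ModularForm.E₆.pow b)), A4 ^ a * A6 ^ b,
    by rw [map_mul, map_pow, map_pow, hA4, hA6, one_pow, one_pow, one_mul], ?_⟩
  rw [ModularForm.qExpansion_mcast, ModularForm.qExpansion_mul one_pos one_mem_strictPeriods_SL,
    ModularForm.qExpansion_pow one_pos one_mem_strictPeriods_SL,
    ModularForm.qExpansion_pow one_pos one_mem_strictPeriods_SL, hE4, hE6, map_mul, map_pow,
    map_pow]

/-- `qExpansion 1 Δ = X · U` with `U ∈ ℤ⟦X⟧` of constant term `1` (the tree's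
`exists_discriminant_qExpansion_natCast_eq_X_pow_mul` at period `1`). [folklore] -/
theorem exists_discriminant_qExpansion_one_eq_X_mul :
    ∃ U : ℤ⟦X⟧, constantCoeff U = 1 ∧
      qExpansion 1 ModularForm.discriminant = X * U.map (Int.castRingHom ℂ) := by
  obtain ⟨U, hU, h⟩ :=
    Literature.NumberTheory.Automorphic.exists_discriminant_qExpansion_natCast_eq_X_pow_mul one_pos
  exact ⟨U, hU, by rwa [Nat.cast_one, pow_one] at h⟩

/-! ### The induction -/

/-- **Sturm's congruence bound at level one, natural weight.** If `F ∈ M_K(SL₂(ℤ))` has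
`q`-expansion the image of `W ∈ ℤ⟦X⟧` and `d ∣ coeff m W` for all `m ≤ K / 12`, then `d` divides
every coefficient of `W`. [folklore] -/
theorem levelOne_forall_dvd_coeff_nat (d : ℤ) (K : ℕ) :
    ∀ (F : ModularForm 𝒮ℒ (K : ℤ)) (W : ℤ⟦X⟧),
      qExpansion 1 ⇑F = W.map (Int.castRingHom ℂ) →
      (∀ m ≤ K / 12, d ∣ coeff m W) → ∀ m, d ∣ coeff m W := by
  induction K using Nat.strong_induction_on with | _ K ih => ?_
  intro F W hF hyp
  -- weights with `M_K = 0`: `K` odd, `K = 2`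
  have hzero : F = 0 → ∀ m, d ∣ coeff m W := fun hF0 m ↦ by
    have hq : qExpansion 1 ⇑F = 0 :=
      (ModularForm.qExpansion_eq_zero_iff one_pos one_mem_strictPeriods_SL F).mpr hF0
    rw [eq_zero_of_map_intCast_eq_zero (hF.symm.trans hq), map_zero]
    exact dvd_zero d
  rcases Nat.even_or_odd K with hK | hK
  swap
  · exact hzero (ModularForm.levelOne_odd_weight_eq_zero (by exact_mod_cast hK) F)
  by_cases hK2 : K = 2
  · subst hK2
    exact hzero (rank_zero_iff_forall_zero.mp ModularForm.levelOne_weight_two_rank_zero F)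
  -- `K` even, `K ≠ 2`: subtract `w₀ E₄ᵃ E₆ᵇ` and divide by `Δ`
  obtain ⟨E, WE, hWE, hE⟩ := exists_levelOne_qExpansion_eq_map_int hK hK2
  obtain ⟨U, hU, hΔ⟩ := exists_discriminant_qExpansion_one_eq_X_mul
  obtain ⟨V, hUV⟩ : ∃ V, U * V = 1 :=
    (isUnit_iff_constantCoeff.mpr (by rw [hU]; exact isUnit_one)).exists_right_inv
  set w₀ : ℤ := constantCoeff W with hw₀def
  have hw₀ : d ∣ w₀ := by
    rw [hw₀def, ← coeff_zero_eq_constantCoeff_apply]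
    exact hyp 0 (Nat.zero_le _)
  -- the integer series `T = V (W - w₀ W_E) = X · W_H`
  set T : ℤ⟦X⟧ := V * (W - C w₀ * WE) with hTdef
  set WH : ℤ⟦X⟧ := PowerSeries.mk fun n ↦ coeff (n + 1) T with hWHdef
  have hT0 : constantCoeff T = 0 := by
    simp only [hTdef, map_sub, map_mul, constantCoeff_C, hWE, mul_one]
    rw [hw₀def, sub_self, mul_zero]
  have hXWH : X * WH = T := by
    conv_rhs => rw [eq_X_mul_shift_add_const T, hT0, map_zero, add_zero]
  have hfac : W - C w₀ * WE = U * (X * WH) := by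
    rw [hXWH, hTdef, ← mul_assoc, hUV, one_mul]
  -- the cusp form `G = F - w₀ E` and the form `H = G / Δ` of weight `K - 12`
  set G : ModularForm 𝒮ℒ (K : ℤ) := F - ((w₀ : ℤ) : ℂ) • E with hGdef
  have hG : qExpansion 1 ⇑G = (W - C w₀ * WE).map (Int.castRingHom ℂ) := by
    rw [hGdef, ModularForm.coe_sub, ModularForm.qExpansion_sub one_pos one_mem_strictPeriods_SL,
      ModularForm.IsGLPos.coe_smul, ModularForm.qExpansion_smul one_pos one_mem_strictPeriods_SL,
      hF, hE, map_sub, map_mul, map_C, eq_intCast, smul_eq_C_mul]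
  have h0 : (qExpansion 1 ⇑G).coeff 0 = 0 := by
    rw [hG, coeff_map, coeff_zero_eq_constantCoeff_apply, map_sub, map_mul, constantCoeff_C, hWE,
      mul_one, hw₀def, sub_self, map_zero]
  set H : ModularForm 𝒮ℒ ((K : ℤ) - 12) :=
    CuspForm.discriminantEquiv (ModularForm.toCuspForm G h0) with hHdef
  have hH : qExpansion 1 ⇑H = WH.map (Int.castRingHom ℂ) := by
    have hne : (X * U.map (Int.castRingHom ℂ) : ℂ⟦X⟧) ≠ 0 := by
      refine mul_ne_zero X_ne_zero fun h ↦ ?_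
      have := congrArg constantCoeff h
      rw [← coeff_zero_eq_constantCoeff_apply, coeff_map, coeff_zero_eq_constantCoeff_apply, hU,
        map_one, map_zero] at this
      exact one_ne_zero this
    refine mul_left_cancel₀ hne ?_
    calc X * U.map (Int.castRingHom ℂ) * qExpansion 1 ⇑H = qExpansion 1 ⇑G := by
          rw [ModularForm.qExpansion_eq_qExpansion_discriminant_mul G h0, hΔ]
      _ = X * U.map (Int.castRingHom ℂ) * WH.map (Int.castRingHom ℂ) := by
          rw [hG, hfac, map_mul, map_mul, map_X]; ring
  -- `d ∣ hₙ` for all `n`: induction hypothesis at weight `K - 12` (or `M_{K-12} = 0`)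
  have hWH : ∀ m, d ∣ coeff m WH := by
    rcases lt_or_ge K 12 with hK12 | hK12
    · have hH0 : ⇑H = 0 := ModularFormClass.levelOne_neg_weight_eq_zero (by omega) H
      have : WH = 0 := eq_zero_of_map_intCast_eq_zero (by rw [← hH, hH0, qExpansion_zero])
      simp [this]
    · have e : (K : ℤ) - 12 = ((K - 12 : ℕ) : ℤ) := by omega
      refine ih (K - 12) (by omega) (ModularForm.mcast e H) WH
        (by rw [ModularForm.qExpansion_mcast, hH]) fun m hm ↦ ?_
      rw [hWHdef, coeff_mk]
      exact dvd_coeff_mul_sub_of_le V W WE hw₀ hyp (by omega)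
  exact forall_dvd_coeff_of_sub_eq hw₀ hfac hWH

/-- **Sturm's congruence bound at level one** (`N = 1` case of Sturm 1987, Thm. 1, for any
integer modulus `d`): if `F ∈ M_k(SL₂(ℤ))` (`k : ℤ`) has `q`-expansion the image of `W ∈ ℤ⟦X⟧`
and `d ∣ coeff m W` for all `m ≤ ⌊k⁺/12⌋`, then `d` divides every coefficient. [folklore] -/
theorem levelOne_forall_dvd_coeff {k : ℤ} (d : ℤ) (F : ModularForm 𝒮ℒ k) (W : ℤ⟦X⟧)
    (hF : qExpansion 1 ⇑F = W.map (Int.castRingHom ℂ))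
    (hyp : ∀ m ≤ k.toNat / 12, d ∣ coeff m W) (m : ℕ) : d ∣ coeff m W := by
  rcases lt_or_ge k 0 with hk | hk
  · have hq : qExpansion 1 ⇑F = 0 := by
      rw [ModularFormClass.levelOne_neg_weight_eq_zero hk F, qExpansion_zero]
    rw [eq_zero_of_map_intCast_eq_zero (hF.symm.trans hq), map_zero]
    exact dvd_zero d
  · lift k to ℕ using hk
    exact levelOne_forall_dvd_coeff_nat d k F W hF (by simpa only [Int.toNat_natCast] using hyp) m

/-- `Γ₁(1) = SL₂(ℤ)`: the congruence conditions modulo `1` are vacuous. [folklore] -/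
theorem Gamma1_one_eq_top : CongruenceSubgroup.Gamma1 1 = ⊤ := by
  ext
  simp [eq_iff_true_of_subsingleton]

/-- **Registered stub `stub_sturmModPrimeLevelOne`** (line `Sketch-ideate-r1-k1`, crux
stmt-Langlands-8485): Sturm's congruence bound modulo a prime `p` over `ℤ` for cusp forms of
level `Γ₁(1) = SL₂(ℤ)` — if `f ∈ S_k(SL₂(ℤ))` has integer `q`-coefficients `zₙ` with `p ∣ zₙ`
for `n ≤ ⌊k · [SL₂(ℤ) : Γ₁(1)] / 12⌋ = ⌊k/12⌋`, then `p ∣ zₙ` for all `n`.  Special case of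
`levelOne_forall_dvd_coeff` (transport along `Γ₁(1) = SL₂(ℤ)`, `[SL₂(ℤ) : Γ₁(1)] = 1`; the
primality of `p` is not needed). [folklore] -/
theorem stub_sturmModPrimeLevelOne :
    ∀ (p : ℕ), p.Prime → ∀ (k : ℤ) (f : CuspForm (CongruenceSubgroup.Gamma1 1) k) (z : ℕ → ℤ),
      (∀ n : ℕ, PowerSeries.coeff n (UpperHalfPlane.qExpansion 1 ⇑f) = (z n : ℂ)) →
      (∀ n : ℕ, n ≤ (k * ((CongruenceSubgroup.Gamma1 1).index : ℤ)).toNat / 12 → (p : ℤ) ∣ z n) →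
      ∀ n : ℕ, (p : ℤ) ∣ z n := by
  intro p _ k f z hz hdiv n
  have hΓ : 𝒮ℒ = (CongruenceSubgroup.Gamma1 1 : Subgroup (GL (Fin 2) ℝ)) := by
    rw [Gamma1_one_eq_top]
    exact MonoidHom.range_eq_map _
  rw [Gamma1_one_eq_top, Subgroup.index_top, Nat.cast_one, mul_one] at hdiv
  have hF : qExpansion 1 ⇑(ModularForm.mcast rfl (f : ModularForm (CongruenceSubgroup.Gamma1 1) k)
      hΓ) = (PowerSeries.mk z).map (Int.castRingHom ℂ) := by
    ext m
    rw [coeff_map, coeff_mk, eq_intCast, ← hz m]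
    rfl
  simpa only [coeff_mk] using
    levelOne_forall_dvd_coeff (p : ℤ) _ (PowerSeries.mk z) hF
      (fun m hm ↦ by rw [coeff_mk]; exact hdiv m hm) n

end Summit.Langlands.Langlands.Theorems.HilbertIntegralOverconvergentIsCongruence

end
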